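import Summits.QuantumFields.GaugeBoot.BootstrapGaugeInvariantLinkCuts
import Summits.QuantumFields.GaugeBoot.BootstrapAllAxesCuts
import HarnessLib

/-!
# The Kazakov–Zheng constraint system on WILSON-LOOP data, transplanted to the torus: all
# symmetries and the gauge-invariant site and link cuts of every axis — sound for `β ≥ 0`,
# infeasible at `β < 0` for `SU(2n+1)` (gauge-boot, L3 ↔ L1)

HONEST FRAMING (cell `pub-gaugeboot`, page 1 of every file): the venture produces certified bounds
on lattice expectations at stated coupling, gauge group, dimension and torus size; NOT a mass gap,
NOT a continuum limit, NOT a string tension; NOT Yang–Mills-summit-bearing (barriers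
`FixedCouplingUltralocality`, `PerturbativeInvisibility`). Structural; it certifies no number; no
certificate of the cell sits at `β < 0`.

## Content

`BootstrapAllAxesCuts` assembled the full torus constraint system with the site and link cuts on ALL
closed-half test functions. The system a Wilson-loop bootstrap actually imposes has the cuts only on
GAUGE-INVARIANT test functions (fewer cuts, larger feasible sets). This module records that the
verdicts do not change:

* `giAllAxesCutsLevelValuesSuN N β n P` — word-level-`n` feasibility, invariance under `allSymmetries`,
  and the site cuts `Θ'_k` and link cuts `Θ_k` of every axis on GAUGE-INVARIANT closed-half test
  functions; `allAxesCutsLevelValues_subset_gi` (it relaxes the plain system),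
  `giAllAxesCutsLevelValues_subset_giLinkCut` (it refines the Wilson-loop link cut family of each axis);
* ★★★ `wilson_mem_giAllAxesCutsLevelValues_suN` (`β ≥ 0`, every `N`), `_suEven` (`SU(2n)`, every `β`),
  `giAllAxesCutsLevelValues_subset_Icc_suN` (convergence);
* ★★★ `giAllAxesCuts_sound_iff_suOdd` — `N` odd, `3 ≤ N`, `N + 3 ≤ 2d`, `(ℤ/2Q)^d`, `Q ≥ 2`: the
  Wilson-loop system keeps the Wilson value feasible at every level for every observable IFF `0 ≤ β`;
  ★★★ `giAllAxesCutsLevelValues_eventually_eq_empty_suOdd` — INFEASIBLE at all large levels at every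
  `β < 0` (`BootstrapGaugeInvariantLinkCuts`); `SU(3)`, `d ≥ 3`: `giAllAxesCuts_sound_iff_su3`,
  ★★ `giAllAxesCuts_su2_sound_su3_infeasible`.

References: V. Kazakov, Z. Zheng, arXiv:2203.11360 §3–§4; P. D. Anderson, M. Kruczenski, Nucl.
Phys. B 921 (2017) 702. Folklore-level.
-/

noncomputable section

open MeasureTheory Filter Topology NormedSpace
open scoped ComplexOrder
open Literature.MathematicalPhysics.QuantumFieldTheory (LatticeRep Site Edge GaugeConfig IsGaugeInvariant wilsonAction
  wilsonMeasure isProbabilityMeasure_wilsonMeasure)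

namespace Summit.QuantumFields.GaugeBoot

open Literature.MathematicalPhysics.QuantumLattice

variable {d Q : ℕ} [NeZero d] [NeZero Q] (N : ℕ) (β : ℝ)

/-- **The level-`n` feasible values of `P` in the Wilson-loop constraint system on `(ℤ/2Q)^d`**:
word-level-`n` `SU(N)` bootstrap feasibility, invariance under `allSymmetries` on the level-`n` test
functions, and the SITE cuts `Θ'_k` and LINK cuts `Θ_k` of every axis `k` on the GAUGE-INVARIANT
level-`n` test functions of the respective closed halves. [folklore] -/
def giAllAxesCutsLevelValuesSuN (n : ℕ) (P : C(GaugeConfig d (2 * Q) (Matrix.specialUnitaryGroup (Fin N) ℂ), ℝ)) :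
    Set ℝ :=
  {t | ∃ φ : C(GaugeConfig d (2 * Q) (Matrix.specialUnitaryGroup (Fin N) ℂ), ℝ) →ₗ[ℝ] ℝ,
    IsBootstrapFeasible (fundamentalLatticeRep N) (suExp N)
        (fun _ => wilsonAction (fundamentalRep (Fin N))) β
        (wordTruncation (ι := Edge d (2 * Q)) (fundamentalLatticeRep N) n) φ ∧
      (∀ R ∈ allSymmetries (d := d) (L := 2 * Q) N,
        ∀ v ∈ wordTruncation (ι := Edge d (2 * Q)) (fundamentalLatticeRep N) n, φ (v.comp R) = φ v) ∧
      (∀ (k : Fin d), ∀ v ∈ wordTruncation (ι := Edge d (2 * Q)) (fundamentalLatticeRep N) n,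
        DependsOn (⇑v) (halfLinks (d := d) Q k) → IsGaugeInvariant (⇑v) → 0 ≤ φ (v.comp (siteReflectCM k) * v)) ∧
      (∀ (k : Fin d), ∀ v ∈ wordTruncation (ι := Edge d (2 * Q)) (fundamentalLatticeRep N) n,
        DependsOn (⇑v) (midHalfLinks (d := d) Q k) → IsGaugeInvariant (⇑v) → 0 ≤ φ (v.comp (midReflectCM k) * v)) ∧
      φ P = t}

/-- The Wilson-loop system relaxes the plain full system (fewer cuts). -/
theorem allAxesCutsLevelValues_subset_gi (n : ℕ)
    (P : C(GaugeConfig d (2 * Q) (Matrix.specialUnitaryGroup (Fin N) ℂ), ℝ)) :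
    allAxesCutsLevelValuesSuN (d := d) (Q := Q) N β n P ⊆ giAllAxesCutsLevelValuesSuN (d := d) (Q := Q) N β n P := by
  rintro t ⟨φ, hφ, hsym, hsite, hlink, rfl⟩
  exact ⟨φ, hφ, hsym, fun k v hv hvS _ => hsite k v hv hvS, fun k v hv hvS _ => hlink k v hv hvS, rfl⟩

/-- The Wilson-loop system refines the Wilson-loop link cut family of every axis. -/
theorem giAllAxesCutsLevelValues_subset_giLinkCut (k : Fin d) (n : ℕ)
    (P : C(GaugeConfig d (2 * Q) (Matrix.specialUnitaryGroup (Fin N) ℂ), ℝ)) :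
    giAllAxesCutsLevelValuesSuN (d := d) (Q := Q) N β n P ⊆
      giRpCutLevelValuesSuN N β (midReflectCM k) (midHalfLinks Q k) n P := by
  rintro t ⟨φ, hφ, -, -, hlink, rfl⟩
  exact ⟨φ, hφ, fun v hv hvS hvG => hlink k v hv hvS hvG, rfl⟩

/-- The Wilson-loop system refines the plain word truncation. -/
theorem giAllAxesCutsLevelValues_subset_levelValues (n : ℕ)
    (P : C(GaugeConfig d (2 * Q) (Matrix.specialUnitaryGroup (Fin N) ℂ), ℝ)) :
    giAllAxesCutsLevelValuesSuN (d := d) (Q := Q) N β n P ⊆ levelValuesSuN (d := d) (L := 2 * Q) N β n P := by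
  rintro t ⟨φ, hφ, -, -, -, rfl⟩
  exact ⟨φ, hφ, rfl⟩

/-- ★★★ **`β ≥ 0`, every `N`: the Wilson value is feasible in the Wilson-loop system at every level.**
[folklore] -/
theorem wilson_mem_giAllAxesCutsLevelValues_suN (hQ : 2 ≤ Q) (hβ : 0 ≤ β) (n : ℕ)
    (P : C(GaugeConfig d (2 * Q) (Matrix.specialUnitaryGroup (Fin N) ℂ), ℝ)) :
    ∫ U, P U ∂(wilsonMeasure (fundamentalRep (Fin N)) β) ∈ giAllAxesCutsLevelValuesSuN (d := d) (Q := Q) N β n P :=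
  allAxesCutsLevelValues_subset_gi N β n P (wilson_mem_allAxesCutsLevelValues_suN N β hQ hβ n P)

/-- ★★★ **`SU(M)`, `M` even, EVERY real `β`: the Wilson value is feasible in the Wilson-loop system at
every level.** [folklore] -/
theorem wilson_mem_giAllAxesCutsLevelValues_suEven {M : ℕ} (hM : Even M) (hQ : 2 ≤ Q) (n : ℕ)
    (P : C(GaugeConfig d (2 * Q) (Matrix.specialUnitaryGroup (Fin M) ℂ), ℝ)) :
    ∫ U, P U ∂(wilsonMeasure (fundamentalRep (Fin M)) β) ∈ giAllAxesCutsLevelValuesSuN (d := d) (Q := Q) M β n P :=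
  allAxesCutsLevelValues_subset_gi M β n P (wilson_mem_allAxesCutsLevelValues_suEven β hM hQ n P)

/-- ★★★ **Convergence of the Wilson-loop system's bounds** (every real `β`). [folklore] -/
theorem giAllAxesCutsLevelValues_subset_Icc_suN {P : C(GaugeConfig d (2 * Q) (Matrix.specialUnitaryGroup (Fin N) ℂ), ℝ)}
    (hP : P ∈ polyAlgebra (ι := Edge d (2 * Q)) (fundamentalLatticeRep N)) {ε : ℝ} (hε : 0 < ε) :
    ∀ᶠ n in atTop, giAllAxesCutsLevelValuesSuN (d := d) (Q := Q) N β n P ⊆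
      Set.Icc (∫ U, P U ∂(wilsonMeasure (fundamentalRep (Fin N)) β) - ε)
        (∫ U, P U ∂(wilsonMeasure (fundamentalRep (Fin N)) β) + ε) := by
  filter_upwards [levelValues_subset_Icc_suN N β hP hε] with n hn
  exact (giAllAxesCutsLevelValues_subset_levelValues N β n P).trans hn

variable {N}

/-- ★★★ **At every `β < 0` the Wilson-loop system is INFEASIBLE at all large levels, for every
objective** (`N` odd, `3 ≤ N`, `N + 3 ≤ 2d`; `(ℤ/2Q)^d`, `Q ≥ 2`): the Wilson-loop link cuts of one
axis already are (`giLinkCutLevelValues_eventually_eq_empty_suOdd`). [folklore] -/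
theorem giAllAxesCutsLevelValues_eventually_eq_empty_suOdd (hQ : 2 ≤ Q) (hN : Odd N) (h3 : 3 ≤ N)
    (hNd : N + 3 ≤ 2 * d) (hβ : β < 0)
    (P : C(GaugeConfig d (2 * Q) (Matrix.specialUnitaryGroup (Fin N) ℂ), ℝ)) :
    ∀ᶠ n in atTop, giAllAxesCutsLevelValuesSuN (d := d) (Q := Q) N β n P = ∅ := by
  filter_upwards [giLinkCutLevelValues_eventually_eq_empty_suOdd β hQ (0 : Fin d) hN h3 hNd hβ P] with n hn
  exact Set.eq_empty_of_subset_empty (hn ▸ giAllAxesCutsLevelValues_subset_giLinkCut N β 0 n P)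

/-- ★★★ **THE WILSON-LOOP CONSTRAINT SYSTEM ON THE TORUS IS CONSISTENT IFF `β ≥ 0`** for `N` odd,
`3 ≤ N`, `N + 3 ≤ 2d` (`(ℤ/2Q)^d`, `Q ≥ 2`). [folklore] -/
theorem giAllAxesCuts_sound_iff_suOdd (hQ : 2 ≤ Q) (hN : Odd N) (h3 : 3 ≤ N) (hNd : N + 3 ≤ 2 * d) :
    (∀ (n : ℕ) (P : C(GaugeConfig d (2 * Q) (Matrix.specialUnitaryGroup (Fin N) ℂ), ℝ)),
        ∫ U, P U ∂(wilsonMeasure (fundamentalRep (Fin N)) β) ∈ giAllAxesCutsLevelValuesSuN (d := d) (Q := Q) N β n P) ↔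
      0 ≤ β := by
  refine ⟨fun h => ?_, fun hβ n P => wilson_mem_giAllAxesCutsLevelValues_suN N β hQ hβ n P⟩
  by_contra hβ
  obtain ⟨n, hn⟩ :=
    (giAllAxesCutsLevelValues_eventually_eq_empty_suOdd β hQ hN h3 hNd (not_le.1 hβ) 1).exists
  have hmem := h n 1
  rw [hn] at hmem
  exact hmem

/-- ★★★ **`SU(3)`, `d ≥ 3`: the Wilson-loop constraint system is consistent IFF `β ≥ 0`.** [folklore] -/
theorem giAllAxesCuts_sound_iff_su3 (hQ : 2 ≤ Q) (hd : 3 ≤ d) :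
    (∀ (n : ℕ) (P : C(GaugeConfig d (2 * Q) (Matrix.specialUnitaryGroup (Fin 3) ℂ), ℝ)),
        ∫ U, P U ∂(wilsonMeasure (fundamentalRep (Fin 3)) β) ∈ giAllAxesCutsLevelValuesSuN (d := d) (Q := Q) 3 β n P) ↔
      0 ≤ β :=
  giAllAxesCuts_sound_iff_suOdd β hQ (by decide) le_rfl (by omega)

/-- ★★ **`SU(2)` versus `SU(3)` on Wilson-loop data at negative coupling** (`d ≥ 3`, `(ℤ/2Q)^d`,
`Q ≥ 2`, `β < 0`): the Wilson-loop system keeps the `SU(2)` Wilson value feasible at every level while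
the `SU(3)` system is eventually infeasible. [folklore] -/
theorem giAllAxesCuts_su2_sound_su3_infeasible (hQ : 2 ≤ Q) (hd : 3 ≤ d) (hβ : β < 0)
    (P₂ : C(GaugeConfig d (2 * Q) (Matrix.specialUnitaryGroup (Fin 2) ℂ), ℝ))
    (P₃ : C(GaugeConfig d (2 * Q) (Matrix.specialUnitaryGroup (Fin 3) ℂ), ℝ)) :
    (∀ n, ∫ U, P₂ U ∂(wilsonMeasure (fundamentalRep (Fin 2)) β) ∈ giAllAxesCutsLevelValuesSuN (d := d) (Q := Q) 2 β n P₂) ∧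
      ∀ᶠ n in atTop, giAllAxesCutsLevelValuesSuN (d := d) (Q := Q) 3 β n P₃ = ∅ :=
  ⟨fun n => wilson_mem_giAllAxesCutsLevelValues_suEven β even_two hQ n P₂,
    giAllAxesCutsLevelValues_eventually_eq_empty_suOdd β hQ (by decide) le_rfl (by omega) hβ P₃⟩

end Summit.QuantumFields.GaugeBoot

end
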